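/-
Copyright (c) 2026 the pub-hodgecm-mathlib formalisation cell (harness21).  Prover seat hodgecm-mathlib-B-p14 (g32), 2026-09-01.  ROAD W brick (W4)
(generic, graph half): the Lefschetz count of a tree automorphism with inversions, on an infinite tree (census `F0/P3a/F0P3a-p04/g13/MEMO-R2wild`).
-/
import Literature.Combinatorics.SimpleGraph.TreeRootedCriterionFixedSubtree   -- ★ `RootedTree.exists_hull_of_finite` (the hull of a finite invariant set), brings ★ `TreeAutomorphismFixedPoints`
import HarnessLib

/-!
# The Lefschetz count of a tree automorphism with inversions (any vertex type)

Topic `Combinatorics/SimpleGraph`, namespace `Literature.Combinatorics.SimpleGraph.TreeAction`.  THEOREMS ONLY: no definition, no named fact, no instance,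
no notation, no `sorry`; kernel lane.  Pure graph theory (Mathlib `SimpleGraph`).

THE MATHEMATICS [Serre1980Trees, I.6.1; Meier2008, Thm. 3.46 and Lemma 3.50].  `G` a tree on ANY vertex type, `α : G ≃g G` with FINITELY many fixed vertices
and finitely many set-wise fixed edges, and SOME finite non-empty `α`-invariant vertex set (e.g. a finite orbit — `α` «bounded»).  With `e₊` = edges fixed
pointwise and `e₋` = edges inverted: the set-wise fixed edges number `e₊ + e₋`, the fixed darts (ordered edges with both ends fixed = fixed flags of the
barycentric subdivision) number `2e₊`, and **`#{v | α v = v} + #{e | α e = e} = #{fixed darts} + 1`** — the Euler characteristic of the `α`-fixed subtree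
of the barycentric subdivision is `1`.  PROOF: the hull (★ `RootedTree.exists_hull_of_finite`) of the invariant set together with all fixed vertices and all ends
of fixed edges is a finite `α`-invariant subtree on which the finite identity ★ `card_fixedVertices_add_card_invertedEdges` (`#FixV + e₋ = e₊ + 1`) holds; the
three counts are then read back on `G` (§1), the darts fibrewise over their edges (Mathlib `dart_edge_fiber_card`).  Consumer: ★-to-be `TreeActionEulerRelation`
(a group acting on a tree with one orbit of vertices: Kottwitz's elliptic Euler–Poincaré relation WITH inversions), hence the wildly ramified places of the
rank-one unitary Euler–Poincaré letter (R2).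
HONEST LABEL: HC_CM is proved only modulo the cell's remaining named inputs (hLiu418, h413) until rung 0 closes; this file is unconditional.

## References
* [Serre1980Trees] J.-P. Serre, *Trees* (1980), Ch. I §6.1 (fixed points of automorphisms of trees).
* [Meier2008] J. Meier, *Groups, Graphs and Trees* (2008), Thm. 3.46, Lemma 3.50.
-/

set_option autoImplicit false

open SimpleGraph MulAction

namespace Literature.Combinatorics.SimpleGraph.TreeAction

/-! ## §1 The Lefschetz count of an automorphism of a tree with finitely many fixed vertices and edges (inversions allowed) -/

section Graph

variable {V : Type*} {G : SimpleGraph V}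

/-- The members of an unordered pair form a finite set. [folklore] -/
private theorem finite_setOf_mem_sym2 (z : Sym2 V) : {v : V | v ∈ z}.Finite := by
  induction z using Sym2.ind with
  | h a b =>
    refine ((Set.finite_singleton b).insert a).subset ?_
    intro v hv
    rcases Sym2.mem_iff.1 hv with rfl | rfl
    · exact Set.mem_insert _ _
    · exact Set.mem_insert_of_mem _ rfl

/-- Vertices of `H` satisfying `Q` = vertices of `G` satisfying `Q`, when `Q ⊆ H`. [folklore] -/
private theorem natCard_subtype_coe_eq {H : Set V} (Q : V → Prop) (hQ : ∀ v, Q v → v ∈ H) :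
    Nat.card {v : H // Q v.1} = Nat.card {v : V // Q v} :=
  Nat.card_congr
    { toFun := fun v => ⟨v.1.1, v.2⟩
      invFun := fun v => ⟨⟨v.1, hQ v.1 v.2⟩, v.2⟩
      left_inv := fun _ => rfl
      right_inv := fun _ => rfl }

/-- Edges of the induced subgraph on `H` satisfying `R` = edges of `G` satisfying `R`, when every `R`-edge has its ends in `H`. [folklore] -/
private theorem natCard_edgeSet_induce_eq {H : Set V} (R : Sym2 V → Prop) (hR : ∀ e ∈ G.edgeSet, R e → ∀ v ∈ e, v ∈ H) :
    Nat.card {e : (G.induce H).edgeSet // R (Sym2.map Subtype.val (e : Sym2 H))} = Nat.card {e : G.edgeSet // R (e : Sym2 V)} := by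
  -- the forward map `e ↦ val_* e`
  have hmem : ∀ e : (G.induce H).edgeSet, Sym2.map Subtype.val (e : Sym2 H) ∈ G.edgeSet := by
    rintro ⟨e, he⟩
    induction e using Sym2.ind with
    | h x y => rw [Sym2.map_mk, SimpleGraph.mem_edgeSet]; exact ((SimpleGraph.mem_edgeSet _).1 he)
  let F : {e : (G.induce H).edgeSet // R (Sym2.map Subtype.val (e : Sym2 H))} → {e : G.edgeSet // R (e : Sym2 V)} :=
    fun e => ⟨⟨Sym2.map Subtype.val (e.1 : Sym2 H), hmem e.1⟩, e.2⟩
  refine Nat.card_congr (Equiv.ofBijective F ⟨?_, ?_⟩)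
  · rintro ⟨⟨e₁, he₁⟩, hR₁⟩ ⟨⟨e₂, he₂⟩, hR₂⟩ h
    have h' : Sym2.map Subtype.val e₁ = Sym2.map Subtype.val e₂ := congrArg (fun x => ((x.1 : G.edgeSet) : Sym2 V)) h
    have : e₁ = e₂ := Sym2.map.injective Subtype.val_injective h'
    subst this
    rfl
  · rintro ⟨⟨e, he⟩, hRe⟩
    induction e using Sym2.ind with
    | h a b =>
      have ha : a ∈ H := hR _ he hRe a (Sym2.mem_mk_left a b)
      have hb : b ∈ H := hR _ he hRe b (Sym2.mem_mk_right a b)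
      have hadj : (G.induce H).Adj ⟨a, ha⟩ ⟨b, hb⟩ := (SimpleGraph.mem_edgeSet _).1 he
      refine ⟨⟨⟨s(⟨a, ha⟩, ⟨b, hb⟩), (SimpleGraph.mem_edgeSet _).2 hadj⟩, ?_⟩, ?_⟩
      · show R (Sym2.map Subtype.val s(⟨a, ha⟩, ⟨b, hb⟩)); rw [Sym2.map_mk]; exact hRe
      · apply Subtype.ext; apply Subtype.ext
        show Sym2.map Subtype.val s(⟨a, ha⟩, ⟨b, hb⟩) = s(a, b)
        rw [Sym2.map_mk]

/-- Darts of the induced subgraph on `H` satisfying `P` = darts of `G` satisfying `P`, when every `P`-dart has its ends in `H`. [folklore] -/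
private theorem natCard_dart_induce_eq {H : Set V} (P : V → V → Prop) (hP : ∀ a b, G.Adj a b → P a b → a ∈ H ∧ b ∈ H) :
    Nat.card {d : (G.induce H).Dart // P d.fst.1 d.snd.1} = Nat.card {d : G.Dart // P d.fst d.snd} := by
  let F : {d : (G.induce H).Dart // P d.fst.1 d.snd.1} → {d : G.Dart // P d.fst d.snd} :=
    fun d => ⟨⟨(d.1.fst.1, d.1.snd.1), d.1.adj⟩, d.2⟩
  refine Nat.card_congr (Equiv.ofBijective F ⟨?_, ?_⟩)
  · rintro ⟨⟨⟨x₁, y₁⟩, h₁⟩, p₁⟩ ⟨⟨⟨x₂, y₂⟩, h₂⟩, p₂⟩ h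
    have h' := congrArg (fun d : {d : G.Dart // P d.fst d.snd} => d.1.toProd) h
    simp only [F] at h'
    obtain ⟨hx, hy⟩ := Prod.mk.inj h'
    have hx' : x₁ = x₂ := Subtype.ext hx
    have hy' : y₁ = y₂ := Subtype.ext hy
    subst hx' hy'
    rfl
  · rintro ⟨⟨⟨a, b⟩, hab⟩, hp⟩
    obtain ⟨ha, hb⟩ := hP a b hab hp
    exact ⟨⟨⟨(⟨a, ha⟩, ⟨b, hb⟩), hab⟩, hp⟩, rfl⟩

/-- **THE LEFSCHETZ COUNT OF A TREE AUTOMORPHISM, INVERSIONS ALLOWED** — for a tree `G` (any vertex type) and `α : G ≃g G` with FINITELY many fixed vertices and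
set-wise fixed edges and SOME finite non-empty invariant vertex set (e.g. a finite orbit): `#{v | α v = v} + #{e | α e = e} = #{darts d | α fixes both ends of d} + 1`.
With `e₊` = edges fixed pointwise and `e₋` = edges inverted, the set-wise fixed edges number `e₊ + e₋` and the fixed darts `2e₊`, so this is the finite identity
`#FixV + e₋ = e₊ + 1` (★ `card_fixedVertices_add_card_invertedEdges`) applied on the hull of the invariant set together with all fixed vertices and all ends of
fixed edges (★ `RootedTree.exists_hull_of_finite`), a finite `α`-invariant subtree. [cite: Serre1980Trees, I.6.1] [cite: Meier2008, Thm. 3.46, Lemma 3.50] -/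
theorem natCard_fixed_add_natCard_fixedEdges_eq (hT : G.IsTree) (α : G ≃g G)
    (hA : {v : V | α v = v}.Finite) (hB : {e : G.edgeSet | Sym2.map α (e : Sym2 V) = e}.Finite)
    {S : Set V} (hS : S.Finite) (hSne : S.Nonempty) (hαS : ∀ s ∈ S, α s ∈ S) :
    Nat.card {v : V // α v = v} + Nat.card {e : G.edgeSet // Sym2.map α (e : Sym2 V) = e} =
      Nat.card {d : G.Dart // α d.fst = d.fst ∧ α d.snd = d.snd} + 1 := by
  classical
  -- members of fixed edges are permuted by `α`
  have hends : ∀ e : G.edgeSet, Sym2.map α (e : Sym2 V) = e → ∀ v ∈ (e : Sym2 V), α v ∈ (e : Sym2 V) := by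
    intro e he v hv
    rw [← he]
    exact Sym2.mem_map.2 ⟨v, hv, rfl⟩
  -- the invariant finite set: `S`, the fixed vertices, the ends of the fixed edges
  set S' : Set V := (S ∪ {v | α v = v}) ∪ {v | ∃ e : G.edgeSet, Sym2.map α (e : Sym2 V) = e ∧ v ∈ (e : Sym2 V)} with hS'
  have hS'f : S'.Finite := by
    refine (hS.union hA).union ?_
    refine (hB.biUnion fun e _ => finite_setOf_mem_sym2 (e : Sym2 V)).subset ?_
    rintro v ⟨e, he, hv⟩
    exact Set.mem_biUnion he hv
  have hS'ne : S'.Nonempty := ⟨hSne.some, Or.inl (Or.inl hSne.some_mem)⟩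
  have hαS' : ∀ s ∈ S', α s ∈ S' := by
    rintro s ((hs | hs) | ⟨e, he, hs⟩)
    · exact Or.inl (Or.inl (hαS s hs))
    · refine Or.inl (Or.inr ?_)
      show α (α s) = α s
      exact congrArg α hs
    · exact Or.inr ⟨e, he, hends e he s hs⟩
  obtain ⟨H, hHf, hS'H, hHc, hHα⟩ := RootedTree.exists_hull_of_finite hT α hS'f hS'ne hαS'
  haveI : Fintype H := hHf.fintype
  -- `α` restricts to an automorphism of the finite tree induced on the hull
  have hbij : Set.BijOn α H H := (Set.Finite.injOn_iff_bijOn_of_mapsTo hHf (fun v hv => hHα v hv)).1 α.injective.injOn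
  let eH : H ≃ H := hbij.equiv α
  have heH : ∀ v : H, ((eH v : H) : V) = α v := fun v => rfl
  let αH : G.induce H ≃g G.induce H :=
    { toEquiv := eH
      map_rel_iff' := by
        intro a b
        change G.Adj ((eH a : H) : V) ((eH b : H) : V) ↔ G.Adj (a : V) (b : V)
        rw [heH, heH]
        exact α.map_adj_iff }
  have hcoe : ∀ v : H, ((αH v : H) : V) = α (v : V) := fun v => rfl
  have hαH : ∀ v : H, αH v = v ↔ α (v : V) = v := fun v => by
    rw [← Subtype.coe_inj, hcoe]
  have hTH : (G.induce H).IsTree := (isTree_iff _).2 ⟨hHc, hT.isAcyclic.induce _⟩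
  -- the finite Lefschetz count on the hull
  have hL := BakerNorine.card_fixedVertices_add_card_invertedEdges hTH αH
  -- where things live
  have hAH : ∀ v : V, α v = v → v ∈ H := fun v hv => hS'H (Or.inl (Or.inr hv))
  have hBH : ∀ e : G.edgeSet, Sym2.map α (e : Sym2 V) = e → ∀ v ∈ (e : Sym2 V), v ∈ H := fun e he v hv => hS'H (Or.inr ⟨e, he, hv⟩)
  -- (c1) fixed vertices
  have c1 : (BakerNorine.fixedVertices αH).card = Nat.card {v : V // α v = v} := by
    rw [← natCard_subtype_coe_eq (fun v => α v = v) hAH, Nat.card_eq_fintype_card,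
      Fintype.card_subtype]
    congr 1
    ext v
    simp only [Finset.mem_filter, Finset.mem_univ, true_and, BakerNorine.mem_fixedVertices_iff, hαH]
  -- (c2) edges fixed pointwise
  have c2 : (BakerNorine.fixedEdges αH).card = Nat.card {e : G.edgeSet // ∀ v ∈ (e : Sym2 V), α v = v} := by
    rw [← natCard_edgeSet_induce_eq (fun z => ∀ v ∈ z, α v = v) (fun e he hR v hv => hAH v (hR v hv)), Nat.card_eq_fintype_card,
      Fintype.card_subtype]
    congr 1
    ext e
    simp only [Finset.mem_filter, Finset.mem_univ, true_and, BakerNorine.fixedEdges]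
    constructor
    · intro h v hv
      obtain ⟨x, hx, rfl⟩ := Sym2.mem_map.1 hv
      exact (hαH x).1 (h x hx)
    · intro h x hx
      exact (hαH x).2 (h x (Sym2.mem_map.2 ⟨x, hx, rfl⟩))
  -- (c3) edges inverted
  have c3 : (BakerNorine.invertedEdges αH).card = Nat.card {e : G.edgeSet // ∀ v ∈ (e : Sym2 V), α v ∈ (e : Sym2 V) ∧ α v ≠ v} := by
    have hR : ∀ e ∈ G.edgeSet, (∀ v ∈ e, α v ∈ e ∧ α v ≠ v) → ∀ v ∈ e, v ∈ H := by
      intro e he hR v hv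
      refine hBH ⟨e, he⟩ ?_ v hv
      -- an inverted edge is fixed set-wise
      induction e using Sym2.ind with
      | h a b =>
        have ha := (hR a (Sym2.mem_mk_left a b)).1
        have hb := (hR b (Sym2.mem_mk_right a b)).1
        have ha' := (hR a (Sym2.mem_mk_left a b)).2
        have hb' := (hR b (Sym2.mem_mk_right a b)).2
        show Sym2.map α s(a, b) = s(a, b)
        rw [Sym2.map_mk, Sym2.eq_iff]
        rcases Sym2.mem_iff.1 ha with h1 | h1
        · exact absurd h1 ha'
        rcases Sym2.mem_iff.1 hb with h2 | h2
        · exact Or.inr ⟨h1, h2⟩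
        · exact absurd h2 hb'
    rw [← natCard_edgeSet_induce_eq (fun z => ∀ v ∈ z, α v ∈ z ∧ α v ≠ v) hR, Nat.card_eq_fintype_card, Fintype.card_subtype]
    congr 1
    ext e
    simp only [Finset.mem_filter, Finset.mem_univ, true_and, BakerNorine.invertedEdges]
    constructor
    · intro h v hv
      obtain ⟨x, hx, rfl⟩ := Sym2.mem_map.1 hv
      obtain ⟨h1, h2⟩ := h x hx
      exact ⟨Sym2.mem_map.2 ⟨αH x, h1, hcoe x⟩, fun h' => h2 ((hαH x).2 h')⟩
    · intro h x hx
      obtain ⟨h1, h2⟩ := h x (Sym2.mem_map.2 ⟨x, hx, rfl⟩)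
      obtain ⟨y, hy, hyx⟩ := Sym2.mem_map.1 h1
      refine ⟨?_, fun h' => h2 ((hαH x).1 h')⟩
      have : αH x = y := Subtype.ext (by rw [hcoe]; exact hyx.symm)
      rw [this]; exact hy
  -- (c4) the set-wise fixed edges split into pointwise fixed and inverted
  have c4 : Nat.card {e : G.edgeSet // Sym2.map α (e : Sym2 V) = e} =
      Nat.card {e : G.edgeSet // ∀ v ∈ (e : Sym2 V), α v = v} + Nat.card {e : G.edgeSet // ∀ v ∈ (e : Sym2 V), α v ∈ (e : Sym2 V) ∧ α v ≠ v} := by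
    have hsplit : ∀ e : G.edgeSet, Sym2.map α (e : Sym2 V) = e ↔
        ((∀ v ∈ (e : Sym2 V), α v = v) ∨ (∀ v ∈ (e : Sym2 V), α v ∈ (e : Sym2 V) ∧ α v ≠ v)) := by
      rintro ⟨e, he⟩
      induction e using Sym2.ind with
      | h a b =>
        have hab : a ≠ b := ((SimpleGraph.mem_edgeSet _).1 he).ne
        show Sym2.map α s(a, b) = s(a, b) ↔ _
        rw [Sym2.map_mk, Sym2.eq_iff]
        constructor
        · rintro (⟨h1, h2⟩ | ⟨h1, h2⟩)
          · left; intro v hv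
            rcases Sym2.mem_iff.1 hv with rfl | rfl
            exacts [h1, h2]
          · right; intro v hv
            rcases Sym2.mem_iff.1 hv with rfl | rfl
            · exact ⟨by rw [h1]; exact Sym2.mem_mk_right _ _, by rw [h1]; exact hab.symm⟩
            · exact ⟨by rw [h2]; exact Sym2.mem_mk_left _ _, by rw [h2]; exact hab⟩
        · rintro (h | h)
          · exact Or.inl ⟨h a (Sym2.mem_mk_left a b), h b (Sym2.mem_mk_right a b)⟩
          · right
            obtain ⟨ha, ha'⟩ := h a (Sym2.mem_mk_left a b)
            obtain ⟨hb, hb'⟩ := h b (Sym2.mem_mk_right a b)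
            rcases Sym2.mem_iff.1 ha with h1 | h1
            · exact absurd h1 ha'
            rcases Sym2.mem_iff.1 hb with h2 | h2
            · exact ⟨h1, h2⟩
            · exact absurd h2 hb'
    have hdisj : ∀ e : G.edgeSet, (∀ v ∈ (e : Sym2 V), α v = v) → (∀ v ∈ (e : Sym2 V), α v ∈ (e : Sym2 V) ∧ α v ≠ v) → False := by
      rintro ⟨e, he⟩ h1 h2
      induction e using Sym2.ind with
      | h a b => exact (h2 a (Sym2.mem_mk_left a b)).2 (h1 a (Sym2.mem_mk_left a b))
    have hset : {e : G.edgeSet | Sym2.map α (e : Sym2 V) = e} =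
        {e : G.edgeSet | ∀ v ∈ (e : Sym2 V), α v = v} ∪ {e : G.edgeSet | ∀ v ∈ (e : Sym2 V), α v ∈ (e : Sym2 V) ∧ α v ≠ v} := by
      ext e; exact hsplit e
    have hfin₁ : {e : G.edgeSet | ∀ v ∈ (e : Sym2 V), α v = v}.Finite := hB.subset fun e he => (hsplit e).2 (Or.inl he)
    have hfin₂ : {e : G.edgeSet | ∀ v ∈ (e : Sym2 V), α v ∈ (e : Sym2 V) ∧ α v ≠ v}.Finite := hB.subset fun e he => (hsplit e).2 (Or.inr he)
    show Nat.card ({e : G.edgeSet | Sym2.map α (e : Sym2 V) = e} : Set G.edgeSet) =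
      Nat.card ({e : G.edgeSet | ∀ v ∈ (e : Sym2 V), α v = v} : Set G.edgeSet) +
        Nat.card ({e : G.edgeSet | ∀ v ∈ (e : Sym2 V), α v ∈ (e : Sym2 V) ∧ α v ≠ v} : Set G.edgeSet)
    rw [Nat.card_coe_set_eq, Nat.card_coe_set_eq, Nat.card_coe_set_eq, hset]
    exact Set.ncard_union_eq (Set.disjoint_left.2 fun e h1 h2 => hdisj e h1 h2) hfin₁ hfin₂
  -- (c5) fixed darts = twice the pointwise fixed edges (counted on the hull)
  have c5 : Nat.card {d : G.Dart // α d.fst = d.fst ∧ α d.snd = d.snd} = 2 * (BakerNorine.fixedEdges αH).card := by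
    rw [← natCard_dart_induce_eq (fun a b => α a = a ∧ α b = b) (fun a b _ h => ⟨hAH a h.1, hAH b h.2⟩), Nat.card_eq_fintype_card,
      Fintype.card_subtype]
    -- fibrewise over the edge map
    have hmaps : ∀ d ∈ (Finset.univ.filter fun d : (G.induce H).Dart => α d.fst.1 = d.fst.1 ∧ α d.snd.1 = d.snd.1),
        (⟨d.edge, d.edge_mem⟩ : (G.induce H).edgeSet) ∈ BakerNorine.fixedEdges αH := by
      intro d hd
      rw [Finset.mem_filter] at hd
      simp only [BakerNorine.fixedEdges, Finset.mem_filter, Finset.mem_univ, true_and]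
      intro v hv
      rw [SimpleGraph.Dart.edge, Sym2.mem_iff] at hv
      rcases hv with rfl | rfl
      · exact (hαH _).2 hd.2.1
      · exact (hαH _).2 hd.2.2
    rw [Finset.card_eq_sum_card_fiberwise hmaps]
    have hfib : ∀ e ∈ BakerNorine.fixedEdges αH,
        ((Finset.univ.filter fun d : (G.induce H).Dart => α d.fst.1 = d.fst.1 ∧ α d.snd.1 = d.snd.1).filter
          fun d => (⟨d.edge, d.edge_mem⟩ : (G.induce H).edgeSet) = e).card = 2 := by
      intro e he
      simp only [BakerNorine.fixedEdges, Finset.mem_filter, Finset.mem_univ, true_and] at he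
      rw [← SimpleGraph.dart_edge_fiber_card (G.induce H) (e : Sym2 H) e.2]
      congr 1
      ext d
      simp only [Finset.mem_filter, Finset.mem_univ, true_and]
      constructor
      · rintro ⟨-, h⟩; exact congrArg Subtype.val h
      · intro h
        have he' : (⟨d.edge, d.edge_mem⟩ : (G.induce H).edgeSet) = e := Subtype.ext h
        refine ⟨⟨?_, ?_⟩, he'⟩
        · exact (hαH _).1 (he d.fst (by rw [← he']; exact Sym2.mem_mk_left _ _))
        · exact (hαH _).1 (he d.snd (by rw [← he']; exact Sym2.mem_mk_right _ _))
    rw [Finset.sum_congr rfl hfib, Finset.sum_const, smul_eq_mul, mul_comm]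
  -- assemble
  rw [c4, c5, ← c1, ← c2, ← c3]
  omega

end Graph


end Literature.Combinatorics.SimpleGraph.TreeAction
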